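import Summits.CriticalPhenomena.SAWScalingLimit.Theorems.SAWTotalPositivityTPToTraversalBoundChainPieces

/-!
# Radial chain for `TPToTraversalBound`, part II-b: heaviness factors through the outside configuration; traversals force heaviness

Crux `SAWTotalPositivity.TPToTraversalBound` (stmt-CriticalPhenomena-10687), line `radial-portal-transfer`,
stub `stub_chain` (bookkeeping: heaviness contraction + top state ⇒ (H1) on interior shells).

`HasPieces.of_outEdgeSet_eq`: for a positive diameter threshold the big maximal outside pieces of a
SAW are determined by its set of edges outside the open box, hence the heaviness is measurable with
respect to the atoms `{outEdgeSet γ = outEdgeSet γ₀}` on which `HeavinessContraction` is stated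
(`findGreatest_eq_of_outEdgeSet_eq`); and the registered sub-goal `stub_chain_transfer`: `2k`
separate traversals of `D(x; ρ, R)` by the mesh polyline give `k` big maximal outside pieces for
every admissible lattice box about `nearestSite δ x`.
-/

noncomputable section

open MeasureTheory Filter Topology Set Metric
open scoped NNReal ENNReal unitInterval
open Literature.Probability.LatticeModels
open Literature.Probability.RandomPlanarGeometry
open Literature.Probability.RandomPlanarGeometry.SAW
open Summit.CriticalPhenomena.SAWScalingLimit.Theses.SAWTotalPositivity

namespace Summit.CriticalPhenomena.SAWScalingLimit.Theorems.TPToTraversalBound.Radial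

variable {Ω : Set ℂ} {δ : ℝ} {u v : Site 2}

/-! ## Heaviness is a function of the outside configuration -/

/-- Membership of a walk edge in the outside configuration. [folklore] -/
theorem mk_getVert_mem_outEdgeSet {γ : DomainSAW Ω δ u v} {c : Site 2} {N t : ℕ}
    (ht : t < γ.walk.length) (h0 : ¬ InOpenBox c N (γ.walk.getVert t))
    (h1 : ¬ InOpenBox c N (γ.walk.getVert (t + 1))) :
    s(γ.walk.getVert t, γ.walk.getVert (t + 1)) ∈ outEdgeSet γ c N := by
  refine ⟨mk_getVert_mem_edges γ ht, fun w hw => ?_⟩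
  rcases Sym2.mem_iff.1 hw with rfl | rfl
  · exact h0
  · exact h1

/-- Inside a maximal outside piece, every step is an edge of the outside configuration.
[folklore] -/
theorem IsOutsidePiece.mk_mem_outEdgeSet {γ : DomainSAW Ω δ u v} {c : Site 2} {N i j : ℕ}
    (h : IsOutsidePiece γ c N i j) {t : ℕ} (hit : i ≤ t) (htj : t < j) :
    s(γ.walk.getVert t, γ.walk.getVert (t + 1)) ∈ outEdgeSet γ c N :=
  mk_getVert_mem_outEdgeSet (lt_of_lt_of_le htj h.2.1) (h.2.2.1 t hit htj.le)
    (h.2.2.1 (t + 1) (by omega) (by omega))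

/-- A vertex of a maximal outside piece with at least one edge is a vertex of every SAW with the
same outside configuration. [folklore] -/
theorem IsOutsidePiece.exists_getVert_eq {γ γ' : DomainSAW Ω δ u v} {c : Site 2} {N i j : ℕ}
    (h : IsOutsidePiece γ c N i j) (hij : i < j)
    (heq : outEdgeSet γ c N = outEdgeSet γ' c N) {t : ℕ} (hit : i ≤ t) (htj : t ≤ j) :
    ∃ q, γ'.walk.getVert q = γ.walk.getVert t ∧ q ≤ γ'.walk.length := by
  rcases htj.lt_or_eq with hlt | rfl
  · have he := h.mk_mem_outEdgeSet hit hlt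
    rw [heq] at he
    exact SimpleGraph.Walk.mem_support_iff_exists_getVert.1
      (γ'.walk.fst_mem_support_of_mem_edges he.1)
  · have he := h.mk_mem_outEdgeSet (t := t - 1) (by omega) (by omega)
    rw [heq, show t - 1 + 1 = t by omega] at he
    exact SimpleGraph.Walk.mem_support_iff_exists_getVert.1
      (γ'.walk.snd_mem_support_of_mem_edges he.1)

/-- **The number of big outside pieces is a function of the outside configuration** (for a
positive diameter threshold `d ≥ 1`): two SAWs with the same set of edges outside the open box
have the same big maximal outside pieces. A big piece has an edge, so its vertices are vertices of
the other walk; following the other walk from one of them one stays inside one maximal outside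
piece of it (leaving would step onto a box vertex, `stub_chain_stretch`), which therefore
contains the two diameter witnesses; distinct pieces of `γ` are separated by a box vertex of `γ`,
so they land in distinct pieces of `γ'`; finally re-index by increasing starting point.
[cite: MadrasSlade1993, §1.2] -/
theorem HasPieces.of_outEdgeSet_eq {γ γ' : DomainSAW Ω δ u v} {c : Site 2} {N d m : ℕ}
    (hd : 1 ≤ d) (heq : outEdgeSet γ c N = outEdgeSet γ' c N) (h : HasPieces γ c N d m) :
    HasPieces γ' c N d m := by
  classical
  obtain ⟨i, j, hi, hk⟩ := h
  have hpiece : ∀ k, IsOutsidePiece γ c N (i k) (j k) := fun k => (hk k).1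
  choose t t' ht using fun k => (hk k).2
  -- the pieces have an edge
  have hij : ∀ k, i k < j k := by
    intro k
    obtain ⟨h1, h2, h3, h4, h5⟩ := ht k
    by_contra hle
    have hieq : i k = j k := le_antisymm (hpiece k).1 (not_lt.1 hle)
    have htt : t k = t' k := by omega
    rw [htt, supDist_self, mul_zero] at h5
    have : (1 : ℤ) ≤ d := by exact_mod_cast hd
    omega
  -- positions in `γ'` of the two diameter witnesses
  have hq := fun k => (hpiece k).exists_getVert_eq (hij k) heq (ht k).1 (ht k).2.1
  have hq' := fun k => (hpiece k).exists_getVert_eq (hij k) heq (ht k).2.2.1 (ht k).2.2.2.1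
  choose q hq hql using hq
  choose q' hq' hq'l using hq'
  -- the stretch of `γ` between the witnesses is a stretch of `γ'`-edges, hence visits every
  -- `γ'`-vertex between `q k` and `q' k`
  have key : ∀ k r, min (q k) (q' k) ≤ r → r ≤ max (q k) (q' k) →
      ∃ s, i k ≤ s ∧ s ≤ j k ∧ γ.walk.getVert s = γ'.walk.getVert r := by
    intro k r hr1 hr2
    have hsteps : ∀ s, i k ≤ s → s < j k →
        s(γ.walk.getVert s, γ.walk.getVert (s + 1)) ∈ γ'.walk.edges := by
      intro s h1 h2
      have he := (hpiece k).mk_mem_outEdgeSet h1 h2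
      rw [heq] at he
      exact he.1
    rcases le_total (t k) (t' k) with hle | hle
    · obtain ⟨s, hs1, hs2, hs3⟩ := stub_chain_stretch γ γ' hle
        (fun s h1 h2 => hsteps s ((ht k).1.trans h1) (lt_of_lt_of_le h2 (ht k).2.2.2.1))
        (hql k) (hq'l k) (hq k).symm (hq' k).symm (r := r) ⟨hr1, hr2⟩
      exact ⟨s, (ht k).1.trans hs1, hs2.trans (ht k).2.2.2.1, hs3⟩
    · obtain ⟨s, hs1, hs2, hs3⟩ := stub_chain_stretch γ γ' hle
        (fun s h1 h2 => hsteps s ((ht k).2.2.1.trans h1) (lt_of_lt_of_le h2 (ht k).2.1))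
        (hq'l k) (hql k) (hq' k).symm (hq k).symm (r := r)
        ⟨by rw [min_comm]; exact hr1, by rw [max_comm]; exact hr2⟩
      exact ⟨s, (ht k).2.2.1.trans hs1, hs2.trans (ht k).2.1, hs3⟩
  -- the maximal piece of `γ'` through `q k`
  have hout_q : ∀ k, ¬ InOpenBox c N (γ'.walk.getVert (q k)) := fun k => by
    rw [hq k]; exact (hpiece k).2.2.1 _ (ht k).1 (ht k).2.1
  have hP := fun k => exists_isOutsidePiece γ' c N (hql k) (hout_q k)
  choose pI pJ hIq hqJ hP using hP
  -- it contains `q' k`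
  have hstay : ∀ k, pI k ≤ q' k ∧ q' k ≤ pJ k := by
    intro k
    constructor
    · by_contra hlt
      push Not at hlt
      obtain ⟨s, hs1, hs2, hs3⟩ := key k (pI k - 1)
        (by have := min_le_right (q k) (q' k); omega)
        (by have := le_max_left (q k) (q' k); have := hIq k; omega)
      have hout := (hpiece k).2.2.1 s hs1 hs2
      rw [hs3] at hout
      rcases (hP k).2.2.2.1 with h0 | hin
      · omega
      · exact hout hin
    · by_contra hlt
      push Not at hlt
      obtain ⟨s, hs1, hs2, hs3⟩ := key k (pJ k + 1)
        (by have := min_le_left (q k) (q' k); have := hqJ k; omega)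
        (by have := le_max_right (q k) (q' k); omega)
      have hout := (hpiece k).2.2.1 s hs1 hs2
      rw [hs3] at hout
      rcases (hP k).2.2.2.2 with h0 | hin
      · have := hq'l k; omega
      · exact hout hin
  -- distinct pieces of `γ` give distinct pieces of `γ'`
  have hsep : ∀ k₁ k₂, k₁ < k₂ → j k₁ + 1 ≤ i k₂ ∧ InOpenBox c N (γ.walk.getVert (j k₁ + 1)) := by
    intro k₁ k₂ hlt
    have hii : i k₁ < i k₂ := hi hlt
    have hji : j k₁ < i k₂ := by
      by_contra hle
      push Not at hle
      have := (hpiece k₁).eq_of_mem (hpiece k₂) (q := i k₂) ⟨hii.le, hle⟩ ⟨le_rfl, (hpiece k₂).1⟩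
      exact absurd this.1 hii.ne
    refine ⟨hji, ?_⟩
    rcases (hpiece k₁).2.2.2.2 with h0 | hin
    · have := (hpiece k₂).2.1; have := (hpiece k₂).1; omega
    · exact hin
  have hIinj : ∀ k₁ k₂, k₁ < k₂ → pI k₁ ≠ pI k₂ := by
    intro k₁ k₂ hlt hI
    have hJ : pJ k₁ = pJ k₂ :=
      ((hP k₁).eq_of_mem (hP k₂) (q := pI k₁) ⟨le_rfl, (hP k₁).1⟩ ⟨hI ▸ le_rfl, hI ▸ (hP k₂).1⟩).2
    obtain ⟨hji, hin⟩ := hsep k₁ k₂ hlt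
    -- the stretch of `γ'` between `q k₁` and `q k₂` lies in one piece of `γ'`
    have hq₂ : pI k₁ ≤ q k₂ ∧ q k₂ ≤ pJ k₁ := by rw [hI, hJ]; exact ⟨hIq k₂, hqJ k₂⟩
    have hsteps : ∀ s, pI k₁ ≤ s → s < pJ k₁ →
        s(γ'.walk.getVert s, γ'.walk.getVert (s + 1)) ∈ γ.walk.edges := by
      intro s h1 h2
      have he := (hP k₁).mk_mem_outEdgeSet h1 h2
      rw [← heq] at he
      exact he.1
    have hr : min (t k₁) (t k₂) ≤ j k₁ + 1 ∧ j k₁ + 1 ≤ max (t k₁) (t k₂) := by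
      have := (ht k₁).2.1; have := (ht k₂).1
      constructor
      · exact (min_le_left _ _).trans (by omega)
      · exact le_trans (by omega) (le_max_right _ _)
    have hlen : j k₁ + 1 ≤ γ.walk.length := hji.trans ((hpiece k₂).1.trans (hpiece k₂).2.1)
    obtain ⟨s, hs1, hs2, hs3⟩ : ∃ s, pI k₁ ≤ s ∧ s ≤ pJ k₁ ∧
        γ'.walk.getVert s = γ.walk.getVert (j k₁ + 1) := by
      rcases le_total (q k₁) (q k₂) with hle | hle
      · obtain ⟨s, hs1, hs2, hs3⟩ := stub_chain_stretch γ' γ hle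
          (fun s h1 h2 => hsteps s ((hIq k₁).trans h1) (lt_of_lt_of_le h2 hq₂.2))
          ((ht k₁).2.1.trans (hpiece k₁).2.1) ((ht k₂).2.1.trans (hpiece k₂).2.1)
          (hq k₁) (hq k₂) (r := j k₁ + 1) hr
        exact ⟨s, (hIq k₁).trans hs1, hs2.trans hq₂.2, hs3⟩
      · obtain ⟨s, hs1, hs2, hs3⟩ := stub_chain_stretch γ' γ hle
          (fun s h1 h2 => hsteps s (hq₂.1.trans h1) (lt_of_lt_of_le h2 (hqJ k₁)))
          ((ht k₂).2.1.trans (hpiece k₂).2.1) ((ht k₁).2.1.trans (hpiece k₁).2.1)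
          (hq k₂) (hq k₁) (r := j k₁ + 1)
          ⟨by rw [min_comm]; exact hr.1, by rw [max_comm]; exact hr.2⟩
        exact ⟨s, hq₂.1.trans hs1, hs2.trans (hqJ k₁), hs3⟩
    have hout := (hP k₁).2.2.1 s hs1 hs2
    rw [hs3] at hout
    exact hout hin
  have hIinj' : Function.Injective pI := by
    intro k₁ k₂ h
    by_contra hne
    rcases lt_or_gt_of_ne hne with hlt | hlt
    · exact hIinj k₁ k₂ hlt h
    · exact hIinj k₂ k₁ hlt h.symm
  -- re-index by increasing starting point
  have hcard : (Finset.univ.image pI).card = m := by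
    rw [Finset.card_image_of_injective _ hIinj', Finset.card_univ, Fintype.card_fin]
  set e := (Finset.univ.image pI).orderEmbOfFin hcard with he
  have hperm : ∀ k, ∃ k', pI k' = e k := fun k => by
    have hmem := Finset.orderEmbOfFin_mem (Finset.univ.image pI) hcard k
    obtain ⟨k', -, hk'⟩ := Finset.mem_image.1 hmem
    exact ⟨k', hk'⟩
  choose perm hperm using hperm
  refine ⟨fun k => pI (perm k), fun k => pJ (perm k), fun a b hab => ?_,
    fun k => ⟨hP (perm k), ?_⟩⟩
  · simp only [hperm]
    exact e.strictMono hab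
  · refine ⟨q (perm k), q' (perm k), hIq _, hqJ _, (hstay _).1, (hstay _).2, ?_⟩
    rw [hq, hq']
    exact (ht (perm k)).2.2.2.2

open Classical in
/-- **Heaviness is measurable with respect to the outside configuration**: for `d ≥ 1` the
number of big maximal outside pieces is the same for two SAWs with the same outside
configuration. [cite: MadrasSlade1993, §1.2] -/
theorem findGreatest_eq_of_outEdgeSet_eq {γ γ' : DomainSAW Ω δ u v} {c : Site 2} {N d : ℕ}
    (hd : 1 ≤ d) (heq : outEdgeSet γ c N = outEdgeSet γ' c N) :
    Nat.findGreatest (HasPieces γ c N d) (γ.walk.length + 1) =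
      Nat.findGreatest (HasPieces γ' c N d) (γ'.walk.length + 1) := by
  refine le_antisymm ?_ ?_
  · exact hasPieces_iff_le_findGreatest.1
      ((hasPieces_iff_le_findGreatest.2 le_rfl).of_outEdgeSet_eq hd heq)
  · exact hasPieces_iff_le_findGreatest.1
      ((hasPieces_iff_le_findGreatest.2 le_rfl).of_outEdgeSet_eq hd heq.symm)
/-- NEAR: a polyline point within `ρ` of `x` sits on a vertex of the open box of half-side
`N > ρ/δ + 3` about the nearest site of `x`. [folklore] -/
theorem inOpenBox_of_dist_le (hδ : 0 < δ) (γ : DomainSAW Ω δ u v) {x : ℂ} {ρ : ℝ} {N : ℕ}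
    (hN : ρ / δ + 3 < N) {t : I} (ht : dist (γ.walk.toCurve (meshPoint δ) t) x ≤ ρ) :
    InOpenBox (nearestSite δ x) N (γ.walk.getVert (pieceIdx γ.walk.support.tail t)) := by
  set w := γ.walk.getVert (pieceIdx γ.walk.support.tail t)
  set c := nearestSite δ x
  have h1 := dist_toCurve_getVert_le hδ.le γ t
  have h2 := dist_meshPoint_nearestSite_le hδ x
  have h3 := le_dist_meshPoint hδ.le w c
  have h4 : dist (meshPoint δ w) (meshPoint δ c) ≤ ρ + 3 * δ := by
    linarith [dist_triangle (meshPoint δ w) (γ.walk.toCurve (meshPoint δ) t) (meshPoint δ c),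
      dist_triangle (γ.walk.toCurve (meshPoint δ) t) x (meshPoint δ c),
      dist_comm (meshPoint δ w) (γ.walk.toCurve (meshPoint δ) t), dist_comm x (meshPoint δ c)]
  have h5 : (supDist w c : ℝ) ≤ ρ / δ + 3 := by
    have key : (supDist w c : ℝ) - 3 ≤ ρ / δ := by
      rw [le_div_iff₀ hδ]
      nlinarith
    linarith
  have h6 : (supDist w c : ℝ) < N := h5.trans_lt hN
  show supDist w c < N
  exact_mod_cast h6

/-- FAR: a polyline point at distance `≥ R ≥ 3Nδ + 3δ` from `x` sits on a vertex at
sup-distance `≥ 3N/2` from the nearest site of `x`. [folklore] -/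
theorem le_supDist_of_le_dist (hδ : 0 < δ) (γ : DomainSAW Ω δ u v) {x : ℂ} {R : ℝ} {N : ℕ}
    (hR : 3 * N * δ + 3 * δ ≤ R) {t : I} (ht : R ≤ dist (γ.walk.toCurve (meshPoint δ) t) x) :
    (3 * N : ℤ) ≤ 2 * supDist (γ.walk.getVert (pieceIdx γ.walk.support.tail t))
      (nearestSite δ x) := by
  set w := γ.walk.getVert (pieceIdx γ.walk.support.tail t)
  set c := nearestSite δ x
  have h1 := dist_toCurve_getVert_le hδ.le γ t
  have h2 := dist_meshPoint_nearestSite_le hδ x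
  have h3 := dist_meshPoint_le hδ.le w c
  have h4 : R - 3 * δ ≤ dist (meshPoint δ w) (meshPoint δ c) := by
    linarith [dist_triangle (γ.walk.toCurve (meshPoint δ) t) (meshPoint δ w) x,
      dist_triangle (meshPoint δ w) (meshPoint δ c) x]
  have h5 : (3 * N : ℝ) * δ ≤ (2 * supDist w c : ℝ) * δ := by nlinarith
  have h6 : (3 * N : ℝ) ≤ (2 * supDist w c : ℝ) := le_of_mul_le_mul_right h5 hδ
  exact_mod_cast h6

/-- A vertex adjacent (along the walk) to a vertex of the open box is within sup-distance `N`
of the centre. [folklore] -/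
theorem supDist_le_of_inOpenBox_succ (γ : DomainSAW Ω δ u v) {c : Site 2} {N t : ℕ}
    (ht : t < γ.walk.length) (hin : InOpenBox c N (γ.walk.getVert (t + 1))) :
    supDist (γ.walk.getVert t) c ≤ N := by
  have h1 := supDist_getVert_succ_le γ ht
  have h2 := supDist_triangle (γ.walk.getVert t) (γ.walk.getVert (t + 1)) c
  have h3 : supDist (γ.walk.getVert (t + 1)) c < N := hin
  omega

/-- **Traversals force heaviness** (registered sub-goal `stub_chain_transfer` of `stub_chain`).
If the mesh polyline of `γ` traverses the shell `D(x; ρ, R)` `2k` separate times, then for every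
box `B_∞(c, N)` about the nearest site `c` of `x` with `ρ/δ + 3 < N` (near points are box
vertices) and `3Nδ + 3δ ≤ R` (far points are at sup-distance `≥ 3N/2`), the walk has `k` maximal
outside pieces of sup-diameter `≥ N/2`: the far vertices of the traversals `0, 2, 4, …` are
separated along the walk by the near vertices of the traversals `1, 3, 5, …`, so they lie in
distinct maximal outside pieces, each of which ends next to a box vertex.
[cite: AizenmanBurchard1999, §1.b] -/
theorem stub_chain_transfer : ∀ {Ω : Set ℂ} {δ : ℝ} {u v : Site 2}, 0 < δ →
    ∀ (γ : DomainSAW Ω δ u v) {x : ℂ} {ρ R : ℝ} {N k : ℕ}, ρ / δ + 3 < N →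
    3 * N * δ + 3 * δ ≤ R →
    (⟨γ.walk.toCurve (meshPoint δ)⟩ : Curve ℂ).HasTraversals (2 * k) x ρ R →
    HasPieces γ (nearestSite δ x) N N k := by
  intro Ω δ u v hδ γ x ρ R N k hN hR htr
  set c := nearestSite δ x with hc
  set Vx : I → ℕ := fun t => pieceIdx γ.walk.support.tail t with hVx
  have hVle : ∀ t, Vx t ≤ γ.walk.length := fun t => (pieceIdx_le _ _).trans
    (by rw [List.length_tail, SimpleGraph.Walk.length_support]; omega)
  have hVmono : ∀ {t t' : I}, t ≤ t' → Vx t ≤ Vx t' := fun h => pieceIdx_mono _ h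
  have hcurve : ∀ t, (⟨γ.walk.toCurve (meshPoint δ)⟩ : Curve ℂ) t =
      γ.walk.toCurve (meshPoint δ) t := fun t => rfl
  obtain ⟨s, t, hst, hsep⟩ := htr
  -- a far and a near time in each traversal
  have hfn : ∀ i, ∃ φ ν : I, s i ≤ φ ∧ φ ≤ t i ∧ s i ≤ ν ∧ ν ≤ t i ∧
      R ≤ dist (γ.walk.toCurve (meshPoint δ) φ) x ∧ dist (γ.walk.toCurve (meshPoint δ) ν) x ≤ ρ := by
    intro i
    obtain ⟨hle, h | h⟩ := hst i
    · exact ⟨t i, s i, hle, le_rfl, le_rfl, hle, h.2, h.1⟩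
    · exact ⟨s i, t i, le_rfl, hle, hle, le_rfl, h.1, h.2⟩
  choose φ ν hsφ hφt hsν hνt hφ hν using hfn
  have hnear : ∀ i, InOpenBox c N (γ.walk.getVert (Vx (ν i))) := fun i =>
    inOpenBox_of_dist_le hδ γ hN (hν i)
  have hfar : ∀ i, (3 * N : ℤ) ≤ 2 * supDist (γ.walk.getVert (Vx (φ i))) c := fun i =>
    le_supDist_of_le_dist hδ γ hR (hφ i)
  have hfar' : ∀ i, ¬ InOpenBox c N (γ.walk.getVert (Vx (φ i))) := fun i h => by
    have h1 := hfar i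
    have h2 : supDist (γ.walk.getVert (Vx (φ i))) c < N := h
    omega
  -- even traversals give far vertices, odd ones near vertices
  set ev : Fin k → Fin (2 * k) := fun i => ⟨2 * i, by omega⟩ with hev
  set od : Fin k → Fin (2 * k) := fun i => ⟨2 * i + 1, by omega⟩ with hod
  set F : Fin k → ℕ := fun i => Vx (φ (ev i)) with hF
  set Nn : Fin k → ℕ := fun i => Vx (ν (od i)) with hNn
  have hFN : ∀ i, F i < Nn i := by
    intro i
    have hlt : ev i < od i := Fin.mk_lt_mk.2 (by simp)
    have hle : F i ≤ Nn i := hVmono ((hφt _).trans ((hsep hlt).le.trans (hsν _)))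
    refine lt_of_le_of_ne hle fun h => hfar' (ev i) ?_
    simp only [hF, hNn] at h
    rw [h]
    exact hnear _
  have hNF : ∀ i i', i < i' → Nn i < F i' := by
    intro i i' hii'
    have hlt : od i < ev i' := Fin.mk_lt_mk.2 (by have := Fin.lt_def.1 hii'; omega)
    have hle : Nn i ≤ F i' := hVmono ((hνt _).trans ((hsep hlt).le.trans (hsφ _)))
    refine lt_of_le_of_ne hle fun h => hfar' (ev i') ?_
    simp only [hF, hNn] at h
    rw [← h]
    exact hnear _
  -- the maximal outside pieces through the far vertices
  have hP := fun i => exists_isOutsidePiece γ c N (hVle (φ (ev i))) (hfar' (ev i))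
  choose pI pJ hIF hFJ hP using hP
  have hJN : ∀ i, pJ i < Nn i := by
    intro i
    by_contra hle
    push Not at hle
    exact (hP i).2.2.1 (Nn i) ((hIF i).trans (hFN i).le) hle (hnear _)
  have hNI : ∀ i i', i < i' → Nn i < pI i' := by
    intro i i' hii'
    by_contra hle
    push Not at hle
    exact (hP i').2.2.1 (Nn i) hle ((hNF i i' hii').le.trans (hFJ i')) (hnear _)
  refine ⟨pI, pJ, fun i i' hii' => ?_, fun i => ⟨hP i, F i, pJ i, hIF i, hFJ i, (hP i).1, le_rfl, ?_⟩⟩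
  · exact lt_of_le_of_lt ((hIF i).trans (hFJ i)) ((hJN i).trans (hNI i i' hii'))
  · -- the piece ends next to a box vertex, the far vertex is at sup-distance `≥ 3N/2`
    have hJlt : pJ i < γ.walk.length := lt_of_lt_of_le (hJN i) (hVle _)
    have hin : InOpenBox c N (γ.walk.getVert (pJ i + 1)) := by
      rcases (hP i).2.2.2.2 with h | h
      · omega
      · exact h
    have h1 := supDist_le_of_inOpenBox_succ γ hJlt hin
    have h2 := hfar (ev i)
    have h3 := supDist_triangle (γ.walk.getVert (F i)) (γ.walk.getVert (pJ i)) c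
    simp only [hF] at h2 h3 ⊢
    omega

end Summit.CriticalPhenomena.SAWScalingLimit.Theorems.TPToTraversalBound.Radial

end
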